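import Summits.HodgeConjecture.HodgeConjecture.Theorems.CyclicUnitaryPowersCupChainFreeSlots
import Summits.HodgeConjecture.HodgeConjecture.Theorems.SignSymmetricPowersMatchingClassesAlgebraic
import Summits.HodgeConjecture.HodgeConjecture.Theorems.CyclicUnitaryPowersHodgeFixedLine
import Literature.AlgebraicGeometry.HodgeTheory.LefschetzOneOneHolds
import Literature.AlgebraicGeometry.HodgeTheory.HypersurfaceCutOutByLefschetz
import Literature.AlgebraicGeometry.HodgeTheory.OddHypersurfaceHodgeConjecture
import Literature.AlgebraicGeometry.HodgeTheory.ComplexConjugationHolds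
import Literature.AlgebraicGeometry.HodgeTheory.HodgeFiltrationModelsReductionProofs
import Literature.AlgebraicGeometry.HodgeTheory.RealStructureSingular
import Literature.AlgebraicGeometry.HodgeTheory.BettiUniverseAxioms
import Literature.AlgebraicGeometry.Motives.FibrePowerSmoothProjective
import Literature.AlgebraicGeometry.Motives.HodgeTensor

/-!
# K2-A stub A: Künneth insertions of cyclic matching tensors are algebraic (route `CyclicUnitaryPowers`, item stmt-HodgeConjecture-19545)

Discharges the registered stub `stub_matchingClassesAlgebraicCyclic` (statement `MatchingClassesAlgebraicCyclic`,
HOME/p3/k2lineA-v6-g23/sig_S_A.txt, skeleton `e821e1634d2d5d3d`, K2-A line `unitary-kunneth-fft` v6, shared by both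
lanes) of the crux `PowersHodgeOfDeckCommutators` of `route-HodgeConjecture-CyclicUnitaryPowers`; landed
`--supports stmt-HodgeConjecture-19545` (it does not close the item; the closing composition is a separate file).
Sorry-free; conditional only on the line's own binder, the Fulton pull-back fact
`fulton1998_map_mem_algebraicClasses` (antecedent of the registered signature; a tree theorem,
`Theorems.fulton1998_map_mem_algebraicClasses_holds`).

## Statement

For a prime `p ≥ 7`, a smooth projective surface `X ⊂ ℙ³` cut out by `x₃^p − f` (`f` a ternary form of degree
`p`), a morphism `σ : X ⟶ X` with the deck properties (`(σ^*)^p = 1`, `σ^*` a `tr ∘ cup`-isometry, rank-one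
invariants, eigenspace Hodge numbers), a limit fan `(Y, π)` of `k + 1` copies of `X`, a class `wdec ∈ H^{2q'}(Y; ℚ)`
with algebraic complexification and a Künneth insertion `E : T^{r,0}H²(X) → H^{2q}(Y)` given on basis tensors by
the left-nested cup chain `wdec ∪ π_{u 0}^* b_{w 0} ∪ ⋯`, the image under `E` of every CYCLIC MATCHING TENSOR
`Σ_w (∏_c M_c[w(ε⁻¹(0,c)), w(ε⁻¹(1,c))]) (∏ₐ coord(zₐ)[w(ε⁻¹ a)]) · ⊗ᵢ b_{w i}` — `ε : Fin r ≃ (Fin 2 × Fin j) ⊕ Fin l`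
a pairing with `l` free slots, pair matrices `M_c = [(σ^*)^{τ c}]_b · G⁻¹`, `G = (tr(bᵢ ∪ bⱼ))`, free slots
carrying `σ^*`-invariant classes `zₐ ∈ H²(X; ℚ)` — has algebraic complexification on `Y`.

## Proof

* §1 `exists_hom_pull_pow`: `f^* ∘ (σ^*)^t = (f ≫ σ ≫ ⋯ ≫ σ)^*`, so absorbing `[(σ^*)^t]_b` into the first slot
  (`SignSymmetricPowersMatchingClassesAlgebraic.sum_toMatrix_mul_smul_eq`, the sign route's stub A — imported, not restated) turns the two-slot insertion of `M_c`
  into a pull-back `(f ≫ σ^t, g)^* κ` of the Poincaré Casimir `κ = Σ (G⁻¹)ᵢⱼ pr₁^*bᵢ ∪ pr₂^*bⱼ` of `H²(X; ℚ)`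
  on `X × X`, whose complexification is algebraic by `ofRatClass_casimir_mem_algebraicClasses`
  (`DiagonalKunnethComponentCasimir`: middle Künneth component of the diagonal; the surface has `H¹ = H³ = 0` and
  algebraic `H⁰, H⁴`, `HypersurfaceCutOutByLefschetz`); pull-backs preserve algebraicity by the Fulton binder.
* §2 `ofRatClass_mem_algebraicClasses_of_pull_eq`: a `σ^*`-INVARIANT class `z ∈ H²(X; ℚ)` is algebraic —
  `σ^*` is a morphism of the Hodge structure `H²(X)` (`pullHodgeHom`), its complex fixed line is one-dimensional
  and hence of type `(1,1)` (`CyclicUnitaryPowersHodgeFixedLine.mem_piece_one_one_of_fixed`), so `z` is a rational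
  Hodge class and the Lefschetz theorem on `(1,1)`-classes (`lefschetzOneOne_rational_holds`, a tree theorem)
  applies.  (The hyperplane class is never used: an abstract deck-`σ` need not fix it.)
* §3 the stub: `E` is linear, so the image is the contraction of the cup chains, and the free-slot re-summation
  `CyclicUnitaryPowersCupChainFreeSlots.ofRatClass_sum_smul_cupChain_free_mem_algebraicClasses` reduces to §1–§2.

## References

* C. Voisin, *Hodge Theory and Complex Algebraic Geometry I* (2002), §11.3.3 (Künneth components of the diagonal),
  Thm. 11.30 (Lefschetz (1,1)); II (2003), Prop. 9.20–9.21. [cite: VoisinHodgeI2002] [cite: VoisinHodgeII2003]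
* W. Fulton, *Intersection Theory* (1998), §19.2 Cor. 19.2 (b) (the binder). [cite: Fulton1998]
-/

-- `Summit.HodgeConjecture.HodgeConjecture.Theorems` is the mandated namespace (single-problem summit), which
-- `linter.dupNamespace` flags; the lakefile turns the linter off tree-wide, restated here for stand-alone checks.
set_option linter.dupNamespace false

noncomputable section

open Finset
open CategoryTheory CategoryTheory.Limits MonoidalCategory CartesianMonoidalCategory
open Literature.AlgebraicGeometry.Motives Literature.AlgebraicGeometry.HodgeTheory
open Literature.AlgebraicGeometry.HodgeTheory.BettiUniverse
open Summit.HodgeConjecture.HodgeConjecture.Theorems.SignSymmetricPowersMatchingClassesAlgebraic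
  (sum_smul_bettiCup_pull_eq_pull_lift sum_toMatrix_mul_smul_eq)
open Summit.HodgeConjecture.HodgeConjecture.Theorems.CyclicUnitaryPowersCupChainFreeSlots
  (ofRatClass_sum_smul_cupChain_free_mem_algebraicClasses)

namespace Summit.HodgeConjecture.HodgeConjecture.Theorems.CyclicUnitaryPowersMatchingClassesAlgebraicCyclic

variable {X Y : SchemeOver ℂ}

/-! ### §1 Powers of `σ^*` are pull-backs along iterates of `σ` -/

/-- **`f^* ∘ (σ^*)^t = (f ≫ σ^{∘t})^*`**: for every `t` there is a morphism `g = σ ≫ ⋯ ≫ σ : X ⟶ X` with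
`f^*((σ^*)^t x) = (f ≫ g)^* x` for all `f : Y ⟶ X` (functoriality of pull-back).
[cite: HatcherAT2002, §3.1 p. 198] -/
theorem exists_hom_pull_pow (σ : X ⟶ X) (n t : ℕ) :
    ∃ g : X ⟶ X, ∀ ⦃Y : SchemeOver ℂ⦄ (f : Y ⟶ X) (x : bettiCohomology X n),
      pull f n ((pull σ n ^ t) x) = pull (f ≫ g) n x := by
  induction t with
  | zero => exact ⟨𝟙 X, fun Y f x ↦ by rw [pow_zero, Module.End.one_apply, Category.comp_id]⟩
  | succ t ih =>
    obtain ⟨g, hg⟩ := ih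
    refine ⟨g ≫ σ, fun Y f x ↦ ?_⟩
    rw [pow_succ, Module.End.mul_apply, hg, ← Category.assoc, pull_comp (f ≫ g) σ n, LinearMap.comp_apply]

/-! ### §2 `σ^*`-invariant classes of `H²(X; ℚ)` are algebraic -/

/-- **Invariant classes are algebraic.** For a smooth projective surface `X`, a morphism `σ : X ⟶ X` with
`(σ^*)^p = 1` on `H²(X; ℚ)` (`p > 0`) and one-dimensional `σ^*`-invariants, every `σ^*`-invariant class
`z ∈ H²(X; ℚ)` has algebraic complexification: `σ^*` is a morphism of Hodge structures, so the complex fixed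
line `ℂ · z` is stable under the Hodge projections and (being a real line) of type `(1,1)`; conclude by the
Lefschetz theorem on `(1,1)`-classes. [cite: VoisinHodgeI2002, §7.3.2 and Thm. 11.30] -/
theorem ofRatClass_mem_algebraicClasses_of_pull_eq (hX : IsSmoothProjective 2 X) (σ : X ⟶ X) {p : ℕ}
    (hp : 0 < p) (hsp : pull σ 2 ^ p = 1)
    (h1 : Module.finrank ℚ ↥(Module.End.eigenspace (pull σ 2) 1) = 1)
    {z : bettiCohomology X 2} (hz : pull σ 2 z = z) :
    ofRatClass (ComplexPoints X) (2 * 1) z ∈ algebraicClasses X 1 := by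
  set H := hodge exists_isReal_hodgeModel_holds hX 2 with hH
  let φ : HodgeStructure.Hom H H :=
    pullHodgeHom exists_isReal_hodgeModel_holds hodgePQ_independent_of_hodgeModel_holds hX hX σ 2
  have hφ : φ.toLinearMap = pull σ 2 := rfl
  have hfix : φ.toLinearMap.baseChange ℂ (HodgeStructure.ofRat z) = HodgeStructure.ofRat z := by
    rw [hφ, HodgeStructure.ofRat_apply, LinearMap.baseChange_tmul, hz]
  have hmem : HodgeStructure.ofRat z ∈ H.piece 1 1 :=
    CyclicUnitaryPowersHodgeFixedLine.mem_piece_one_one_of_fixed H (by norm_num) φ hp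
      (by rw [hφ]; exact hsp) (by rw [hφ]; exact h1) hfix
  have hcl : z ∈ H.hodgeClasses 1 := (H.mem_hodgeClasses_iff 1 z).2 (H.piece_le_F 1 1 hmem)
  have hT : IsOfHodgeType 2 X (2 * 1) 1 1 (ofRatClass (ComplexPoints X) (2 * 1) z) :=
    (HodgeModel.mem_hodgeClasses_iff_isOfHodgeType (realHodgeModel exists_isReal_hodgeModel_holds hX) hX
      hodgePQ_independent_of_hodgeModel_holds (realHodgeModel_isHodgeSymmetric exists_isReal_hodgeModel_holds hX)
      1 z).1 hcl
  have hrat : IsRationalClass (ofRatClass (ComplexPoints X) (2 * 1) z) :=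
    (isRationalClass_iff_mem_range_ofRatClass _).2 ⟨z, rfl⟩
  exact lefschetzOneOne_rational_holds hX _ hrat hT

/-! ### §3 The stub -/

/-- **`stub_matchingClassesAlgebraicCyclic`** (K2-A line `unitary-kunneth-fft` v6, registered signature verbatim):
granted Fulton's pull-back fact, the Künneth insertion `E t` of every cyclic matching tensor `t` of
`T^{r,0}H²(X; ℚ)` (pairing `ε` with free slots, tags `τ`, Casimirs of the trace form twisted by powers of `σ^*`,
free slots filled with `σ^*`-invariant classes) has algebraic complexification on the fibre power `Y` of the
smooth `p`-cyclic surface `X`.  Primality and `p ≥ 7` are used only through `p > 0`.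
[cite: VoisinHodgeI2002, §11.3.3 Thm. 11.38, Lemma 11.41 and Thm. 11.30]
[cite: VoisinHodgeII2003, proof of Prop. 9.20 and Prop. 9.21 (i)] [cite: Fulton1998, §19.2 Cor. 19.2 (b)] -/
theorem stub_matchingClassesAlgebraicCyclic :
    open Literature.AlgebraicGeometry.Motives Literature.AlgebraicGeometry.HodgeTheory Literature.AlgebraicGeometry.HodgeTheory.BettiUniverse CategoryTheory.Limits in let pmul : List ℕ → List ℕ → List ℕ := fun a b => (List.range (a.length + b.length - 1)).map fun k => ((List.range (k + 1)).map fun i => a.getD i 0 * b.getD (k - i) 0).sum; let ehn : ℕ → ℕ → ℕ → ℕ := fun p j q => if (q + 1) * p < 3 + j then 0 else ((List.replicate 3 (List.replicate (p - 1) 1)).foldl pmul [1]).getD ((q + 1) * p - 3 - j) 0; let Deck : (p : ℕ) → (X : SchemeOver ℂ) → IsSmoothProjective 2 X → (X ⟶ X) → Prop := fun p X hX σ => pull σ 2 ^ p = 1 ∧ (∀ x y, tr hX (2 + 2) (cup X 2 2 (pull σ 2 x) (pull σ 2 y)) = tr hX (2 + 2) (cup X 2 2 x y)) ∧ Module.finrank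 ℚ ↥(Module.End.eigenspace (pull σ 2) 1) = 1 ∧ ∃ ζ : ℂ, IsPrimitiveRoot ζ p ∧ ∀ j q : ℕ, 1 ≤ j → j < p → q ≤ 2 → Module.finrank ℂ ↥(Module.End.eigenspace ((pull σ 2).baseChange ℂ) (ζ ^ j) ⊓ (hodge exists_isReal_hodgeModel_holds hX 2).piece ((2 : ℤ) - q) q) = ehn p j q; Literature.AlgebraicGeometry.HodgeTheory.fulton1998_map_mem_algebraicClasses → ∀ ⦃p : ℕ⦄, p.Prime → 7 ≤ p → ∀ ⦃X : SchemeOver ℂ⦄ (hX : IsSmoothProjective 2 X), (∃ f : MvPolynomial (Fin 3) ℂ, f.IsHomogeneous p ∧ IsHypersurfaceCutOutBy 3 (MvPolynomial.X (Fin.last 3) ^ p - MvPolynomial.rename Fin.castSucc f) X) → ∀ [Module.Finite ℚ (bettiCohomology X 2)] (σ : X ⟶ X), Deck p X hX σ → ∀ ⦃k : ℕ⦄ ⦃Y : SchemeOver ℂ⦄ (π : Fin (k + 1) → (Y ⟶ X)) (hlim : IsLimit (Fan.mk Y π)) (q q' r : ℕ) (u : Fin r → Fin (k + 1)) (wdec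 : bettiCohomology Y (2 * q')), ofRatClass (ComplexPoints Y) (2 * q') wdec ∈ algebraicClasses Y q' → ∀ (E : hodgeTensorSpace (bettiCohomology X 2) r 0 →ₗ[ℚ] bettiCohomology Y (2 * q)), (∀ w : Fin r → Fin (Module.finrank ℚ (bettiCohomology X 2)), (⟨2 * q, E ((PiTensorProduct.tprod ℚ fun i => (Module.finBasis ℚ (bettiCohomology X 2)) (w i)) ⊗ₜ[ℚ] (PiTensorProduct.tprod ℚ fun i : Fin 0 => (Fin.elim0 i : Module.Dual ℚ (bettiCohomology X 2))))⟩ : Σ n, bettiCohomology Y n) = List.foldl (fun (acc : Σ n, bettiCohomology Y n) (i : Fin r) => ⟨acc.1 + 2, cup Y acc.1 2 acc.2 (pull (π (u i)) 2 ((Module.finBasis ℚ (bettiCohomology X 2)) (w i)))⟩) ⟨2 * q', wdec⟩ (List.finRange r)) → ∀ (j l : ℕ) (ε : Fin r ≃ (Fin 2 × Fin j) ⊕ Fin l) (τ : Fin j → Fin p) (z : Fin l → (bettiCohomology X 2)), (∀ a, (pull σ 2) (z a) = z a) → ofRatClass (ComplexPoints Y) (2 * q) (E (∑ w : Fin r →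 Fin (Module.finrank ℚ (bettiCohomology X 2)), ((∏ c : Fin j, (LinearMap.toMatrix (Module.finBasis ℚ (bettiCohomology X 2)) (Module.finBasis ℚ (bettiCohomology X 2)) ((pull σ 2) ^ ((τ c : Fin p) : ℕ)) * (Matrix.of fun a a' => ((cup X 2 2).compr₂ (tr hX (2 + 2))) ((Module.finBasis ℚ (bettiCohomology X 2)) a) ((Module.finBasis ℚ (bettiCohomology X 2)) a'))⁻¹) (w (ε.symm (Sum.inl (0, c)))) (w (ε.symm (Sum.inl (1, c))))) * ∏ a : Fin l, ((Module.finBasis ℚ (bettiCohomology X 2)).repr (z a)) (w (ε.symm (Sum.inr a)))) • ((PiTensorProduct.tprod ℚ fun i => (Module.finBasis ℚ (bettiCohomology X 2)) (w i)) ⊗ₜ[ℚ] (PiTensorProduct.tprod ℚ fun i : Fin 0 => (Fin.elim0 i : Module.Dual ℚ (bettiCohomology X 2)))))) ∈ algebraicClasses Y q := by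
  intro pmul ehn Deck hP p hp _h7 X hX hf _inst σ hDeck k Y π hlim q q' r u wdec hwdec E hE j l ε τ z hz
  classical
  obtain ⟨f, hfd, hcut⟩ := hf
  obtain ⟨hsp, -, hfix1, -⟩ := hDeck
  have hXp : (MvPolynomial.X (Fin.last 3) ^ p : MvPolynomial (Fin 4) ℂ).IsHomogeneous p := by
    simpa using (MvPolynomial.isHomogeneous_X ℂ (Fin.last 3)).pow p
  have hF : (MvPolynomial.X (Fin.last 3) ^ p - MvPolynomial.rename Fin.castSucc f :
      MvPolynomial (Fin 4) ℂ).IsHomogeneous p := hXp.sub hfd.rename_isHomogeneous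
  have hF0 : MvPolynomial.X (Fin.last 3) ^ p - MvPolynomial.rename Fin.castSucc f ≠ 0 :=
    hX.ne_zero_of_isHypersurfaceCutOutBy hcut
  have hY : IsSmoothProjective (2 * (k + 1)) Y := isSmoothProjective_of_isLimit_fan hX π hlim
  have hXX : IsSmoothProjective (2 + 2) (X ⊗ X) := hX.tensor_holds hX
  have h2 : 2 + 2 = 2 * 2 := rfl
  set b := Module.finBasis ℚ (bettiCohomology X 2) with hb
  set G : Matrix (Fin (Module.finrank ℚ (bettiCohomology X 2))) (Fin (Module.finrank ℚ (bettiCohomology X 2))) ℚ :=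
    Matrix.of fun i i' ↦ ((cup X 2 2).compr₂ (tr hX (2 + 2))) (b i) (b i') with hG
  -- the Poincaré Casimir of `H²(X; ℚ)` on `X × X` is algebraic
  have hκ : ofRatClass (ComplexPoints (X ⊗ X)) (2 * 2)
      (∑ i, ∑ i', G⁻¹ i i' • bettiCup h2 (pull (fst X X) 2 (b i)) (pull (snd X X) 2 (b i'))) ∈
      algebraicClasses (X ⊗ X) 2 :=
    ofRatClass_casimir_mem_algebraicClasses hX
      (fun j hj hjn ↦ subsingleton_bettiCohomology_of_odd (n := 2) hX hF hF0 hcut hj hjn)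
      (fun a z' ha ↦ by
        rw [algebraicClasses_eq_top_of_isHypersurfaceCutOutBy (n := 2) hX hF hF0 hcut ha]
        exact Submodule.mem_top) b h2
  -- its two-slot pull-backs are algebraic
  have hT : ∀ f' g' : Y ⟶ X, ofRatClass (ComplexPoints Y) (2 * 2)
      (∑ i, ∑ i', G⁻¹ i i' • bettiCup h2 (pull f' 2 (b i)) (pull g' 2 (b i'))) ∈ algebraicClasses Y 2 := by
    intro f' g'
    rw [sum_smul_bettiCup_pull_eq_pull_lift h2]
    exact ofRatClass_pull_mem_algebraicClasses hP hXX hY (lift f' g') hκ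
  -- the two-slot insertions of the tagged pair matrices `[(σ^*)^{τ c}]_b · G⁻¹` are algebraic
  have hΘ : ∀ (mm : Fin j) (f' g' : Y ⟶ X), ofRatClass (ComplexPoints Y) (2 * 2)
      (∑ i, ∑ i', (LinearMap.toMatrix b b (pull σ 2 ^ ((τ mm : Fin p) : ℕ)) * G⁻¹) i i' •
        bettiCup h2 (pull f' 2 (b i)) (pull g' 2 (b i'))) ∈ algebraicClasses Y 2 := by
    intro mm f' g'
    have habs := sum_toMatrix_mul_smul_eq b (pull σ 2 ^ ((τ mm : Fin p) : ℕ)) G⁻¹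
      ((bettiCup h2).compl₁₂ (pull f' 2) (pull g' 2))
    simp only [LinearMap.compl₁₂_apply] at habs
    rw [habs]
    obtain ⟨g, hg⟩ := exists_hom_pull_pow σ 2 ((τ mm : Fin p) : ℕ)
    simp only [hg]
    exact hT (f' ≫ g) g'
  -- the free slots: `σ^*`-invariant classes are algebraic
  have hc : ∀ a : Fin l, ofRatClass (ComplexPoints X) (2 * 1) (∑ i, (b.repr (z a)) i • b i) ∈
      algebraicClasses X 1 := by
    intro a
    rw [b.sum_repr (z a)]
    exact ofRatClass_mem_algebraicClasses_of_pull_eq hX σ hp.pos hsp hfix1 (hz a)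
  -- the free-slot re-summation theorem
  rw [map_sum E]
  simp only [map_smul]
  exact ofRatClass_sum_smul_cupChain_free_mem_algebraicClasses hP hX hY 1 rfl b π u q' wdec hwdec q
    (fun w ↦ E ((PiTensorProduct.tprod ℚ fun i => b (w i)) ⊗ₜ[ℚ]
      (PiTensorProduct.tprod ℚ fun i : Fin 0 => (Fin.elim0 i : Module.Dual ℚ (bettiCohomology X 2)))))
    hE ε (fun mm i i' ↦ (LinearMap.toMatrix b b (pull σ 2 ^ ((τ mm : Fin p) : ℕ)) * G⁻¹) i i') hΘ
    (fun a i ↦ (b.repr (z a)) i) hc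

end Summit.HodgeConjecture.HodgeConjecture.Theorems.CyclicUnitaryPowersMatchingClassesAlgebraicCyclic

end
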